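import Literature.MathematicalPhysics.QuantumFieldTheory.Balaban1983to89.B9Ineq346GpAtLetters
import Literature.MathematicalPhysics.QuantumFieldTheory.Balaban1983to89.Node00.CarriersB6KDischarge

/-!
# `Balaban1983to89.B9Ineq343GpAtLetters` — [B9] (3.43) AT U = 1 FOR G′(1) AT NODE 00's OPERATOR LAYER OF LETTERS: the Hölder leaf of row 11
# (`hGp`) AS TYPED AT THE RECORD is a THEOREM at `ops := Node00.opsYOfLetters N θ M⋆ 𝔏 𝔈`, for EVERY letter record `𝔏` — [4] Prop. 2.2 (2.67)₄,₅
# on NODE 00's tower geometry (`Node00.prop22_tower`) + dag-n06-f's row 2 at the instance (`Gp_h1_one_le`)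

T. Bałaban, *Propagators for lattice gauge theories in a background field*, Commun. Math. Phys. **99** (1985) 389–434
[`Balaban1985BackgroundPropagators`, "B9"]; [4] = T. Bałaban, *Propagators and renormalization transformations for lattice
gauge theories. II*, Commun. Math. Phys. **96** (1984) 223–250 [`Balaban1984PropagatorsII`].

statement-level skeleton of published theorems with citation tags; proofs where landed; nothing here is a claim about the
Yang–Mills mass gap

THE PRINTED LOCI (verbatim).  (3.43), p. 398: *"‖ζ∇_UG′(U)λ‖_β, ‖ζG′(U)∇\*_Uλ‖_β ≦ B₀(β)(Lʲη)^{1−β}(‖ζ‖_β + |ζ|)e^{−δ₀d(y,y′)}|λ| for 0 ≦ β ≦ β₀ < 1,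
ζ ∈ C₀^∞(Δ̃(y)), y ∈ Λ_j, supp λ ⊂ Δ(y′)"*; [4] Prop. 2.2 (2.67) p. 234, entries 4–5: *"‖ζ∇G′λ‖_α, ‖ζG′∇\*λ‖_α ≤ O(1)(Lʲη)^{1−α}(‖ζ‖_α + |ζ|)
e^{−δ₀d(y,y′)}|λ| … supp ζ ⊂ B^j(y)"* (the SMALL cube); Cor. 3.5 p. 407: *"for U = 1 these theorems are proved in [4]"*.

THE POINT.  The (3.43) leaf of row 11, `AtOneH1On … (fun _ lam => ¬ lam.isRight)` (`B9ResidualEntriesAtOne`), asks `H1BlockOn` with the geometry's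
Δ̃-cut-off predicate `cutInT`.  At the Stage-3′(Y) READING OF RECORD (`B9GeoNormsKLevelV1.geo9K`, field `cutInT := (kGeoU i).cutIn`; the located
caveat G-B6-2138-SUPP of dag-n03-b ∕ def-Y: the Δ̃-faithful variant is the un-swapped `geo9KT`) the site cut-off class IS the one-block class of
NODE 00's tower geometry `kGeoU` — exactly the class of (2.67)₄,₅.  NODE 00 proved Prop. 2.2 on that geometry for its reading `GpU` of G′ = Δ′_a⁻¹
(`Node00.prop22_tower`, from lit-balaban-p21's torus census `prop22Printed_kLevelTorusP`), and dag-n06-f proved row 2 at def-Y's instance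
(`B9Cor35ComparisonsGpCAtLetters.Gp_h1_one_le`: the reading's (3.43) slot at U = 1 is `≤ GpU.h1`, flatness clauses `Gp_one`, `parS_one`).  Composing the two
(every geometric field of `geo9Y x` IS the corresponding field of `kGeoU x.toKIdx`, `B9GeoNormsKLevelV1.dict_*`): the leaf is a theorem at the layer of
letters for every `𝔏 𝔈` — §1 ★★ `atOneH1On_Gp_letters`; §2 ★★ `residualGpAtOne_letters_of_leaves5` (ROW 11 at the layer ⇐ (3.46)₃,₄,₅ + (3.44) + (3.45):
the second-order entries `∇G′∇*`, `∇∇G′`, `G′∇*∇*` of G′(1), which have no counterpart in [4]); §3 record ★★ `atOneH1On_Gp_opsYOfLetters`,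
★★ `hGp_opsYOfLetters_of_leaves5`.

HONEST SCOPE.  The (3.43) leaf is discharged AS TYPED AT THE RECORD, i.e. for the one-block cut-off class of the reading of record; print's Δ̃(y)
(a bounded union of blocks) is the located reading caveat G-B6-2138-SUPP (swap to `geo9KT`), NOT closed here.  The analytic content is p21's torus
Prop. 2.2 (via `Node00.prop22_tower`) and n06-f's comparison, only READ.  The letters are NOT constructed (def-Y's successor `lettersYOfRecord`);
nothing of [B9] is asserted; count-neutral; N06 NOT discharged; one finite lattice programme — nothing continuum, nothing about the mass gap.  Cell
`pub-ymgap` (HUMAN RULING D-0062), Track A node N06 [B9], N06-ASSIGNMENT v1 row 11 (bundle F3) at def-Y's instance, seat `pub-ymgap-dag-n06-h` (g2),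
2026-08-27.
-/

noncomputable section

namespace Literature.MathematicalPhysics.QuantumFieldTheory.Balaban1983to89.B9Ineq343GpAtLetters

open B6KLevelCensusIndexV1 (KIdx kGeo)
open B9Cor35ComparisonsGpCAtLetters (Gp_h1_one_le)
open B9Ineq347GpAtLetters (atOneGlobOn_Gp_letters)
open B9Ineq346GpAtLetters (atOneL2nOn_Gp_letters_0 atOneL2nOn_Gp_letters_1 atOneL2nOn_Gp_letters_2)
open B9FromB6 (ResidualGpAtOne)
open B9ResidualEntriesAtOne (AtOneL2nOn AtOneH1On AtOneE4On AtOneH2On atOneL2On_of_members)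
open B9ResidualEntriesAtOneAtLetters (residualGpAtOne_letters_of_blocksOn)
open B9PinMembersKLevelV1 (MemberY geo9Y bg9Y)
open B7Prop2SpecialUnitary (specialUnitaryUnits)
open Node00

variable {d ℓ : ℕ} {hd : 1 ≤ d + 1} {hL : Odd (ℓ + 1) ∧ 1 < ℓ + 1} {b₀ b₁ : ℝ} {Mstar : ℕ}
variable {𝔸 : Type} [NormedRing 𝔸] [NormedAlgebra ℂ 𝔸] [CompleteSpace 𝔸]

/-! ## §1 The (3.43) leaf of G′(1), as typed at the record, at the layer of letters -/

section Layer

variable {G : Subgroup 𝔸ˣ} (𝔏 : ∀ x : MemberY d ℓ hd hL b₀ b₁ Mstar, CovLettersY 𝔸 x)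
  (𝔈 : ∀ x : MemberY d ℓ hd hL b₀ b₁ Mstar, ExpLettersY 𝔸 G x)

/-- ★★ **THE (3.43) LEAF OF ROW 11 (AS TYPED AT THE RECORD) HOLDS AT NODE 00's LAYER OF LETTERS** — for EVERY family of letter records `𝔏` (printed
`U = 1` clauses `Gp_one`, `parS_one`) and `𝔈`: one threshold, one rate `δ₀`, one `B₀(·)` such that for every member above the threshold, every site
argument `λ` supported in `Δ(y′)`, every cut-off `ζ` of the record's class at `y` and `0 ≤ β < 1`:
`(ops x).Gp.h1 1 λ β ζ ≤ B₀(β)(Lʲη)^{1−β}(‖ζ‖_β + |ζ|)e^{−δ₀d(y,y′)}|λ|` — [4] (2.67)₄,₅ on NODE 00's tower (`Node00.prop22_tower`) composed with row 2 at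
the instance (`Gp_h1_one_le`); at `geo9Y` the fields `cutInT`, `suppIn`, `len`, `cutH`, `dist`, `supNorm` ARE those of `kGeoU`.
[cite: Balaban1985BackgroundPropagators, Thm 3.1 (3.43) p.398 + Cor. 3.5 p.407; Balaban1984PropagatorsII, Prop. 2.2 (2.67) p.234 (entries 4, 5)] -/
theorem atOneH1On_Gp_letters :
    AtOneH1On geo9Y (bg9Y 𝔸 G) (fun x => (operatorLayerYOfLetters 𝔸 G x (𝔏 x) (𝔈 x)).Gp) (fun _ lam => ¬ (lam.isRight = true)) := by
  by_cases hℓ : 1 ≤ ℓ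
  swap
  · exact ⟨1, 1, fun _ => 0, one_pos, one_pos, fun x => absurd (le_trans (by norm_num) x.hℓ) hℓ⟩
  obtain ⟨M₁, δ₀, _C, Cα, hM₁, hδ₀, -, H⟩ := Node00.prop22_tower (d := d) (hd := hd) (hL := hL) (b₀ := b₀) (b₁ := b₁) hℓ
  refine ⟨M₁, δ₀ / 2, Cα, hM₁, half_pos hδ₀, fun x hx β lam ζ y y' _ hβ0 hβ1 hζ hs => ?_⟩
  have h22 := (H ⟨x.toKIdx, x.hcfk⟩ trivial hx).2 β lam ζ y y' hβ0 hβ1 hζ hs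
  exact (Gp_h1_one_le x (𝔏 x) (𝔈 x) lam β ζ).trans h22

/-- ★★ **ROW `hGp` AT THE LAYER OF LETTERS FROM THE FIVE SECOND-ORDER LEAVES ONLY** — the (3.46) member-leaves n = 3, 4, 5 (`∇G′∇*`, `∇∇G′`,
`G′∇*∇*` in `L²`), (3.44) and (3.45) for G′(1) on site arguments: the entries with NO counterpart in [4] (cell GAP G-B9-03a); the (3.47) leaf
(`B9Ineq347GpAtLetters`), the (3.46) members 0, 1, 2 (`B9Ineq346GpAtLetters`) and the (3.43) leaf (this file) are PROVED; signs by dag-n03-b's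
`modelSignsOn_geo9K`. [cite: Balaban1985BackgroundPropagators, Cor. 3.5 p.407 + Thm 3.1 (3.43)–(3.47) p.398; Balaban1984PropagatorsII, Prop. 2.2 (2.67), Lemma 2.1 p.234] -/
theorem residualGpAtOne_letters_of_leaves5
    (hL3 : AtOneL2nOn geo9Y (bg9Y 𝔸 G) (fun x => (operatorLayerYOfLetters 𝔸 G x (𝔏 x) (𝔈 x)).Gp) (fun _ lam => ¬ (lam.isRight = true)) 3)
    (hL4 : AtOneL2nOn geo9Y (bg9Y 𝔸 G) (fun x => (operatorLayerYOfLetters 𝔸 G x (𝔏 x) (𝔈 x)).Gp) (fun _ lam => ¬ (lam.isRight = true)) 4)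
    (hL5 : AtOneL2nOn geo9Y (bg9Y 𝔸 G) (fun x => (operatorLayerYOfLetters 𝔸 G x (𝔏 x) (𝔈 x)).Gp) (fun _ lam => ¬ (lam.isRight = true)) 5)
    (hE4 : AtOneE4On geo9Y (bg9Y 𝔸 G) (fun x => (operatorLayerYOfLetters 𝔸 G x (𝔏 x) (𝔈 x)).Gp) (fun _ lam => ¬ (lam.isRight = true)))
    (hH2 : AtOneH2On geo9Y (bg9Y 𝔸 G) (fun x => (operatorLayerYOfLetters 𝔸 G x (𝔏 x) (𝔈 x)).Gp) (fun _ lam => ¬ (lam.isRight = true))) :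
    ResidualGpAtOne geo9Y (bg9Y 𝔸 G) (fun x => (operatorLayerYOfLetters 𝔸 G x (𝔏 x) (𝔈 x)).Gp) := by
  refine residualGpAtOne_letters_of_blocksOn 𝔏 𝔈 ?_ (atOneGlobOn_Gp_letters 𝔏 𝔈) (atOneH1On_Gp_letters 𝔏 𝔈) hE4 hH2
  refine atOneL2On_of_members (fun x => B9GeoNormsKLevelModelSignsV1.modelSignsOn_geo9K x.toKIdx) fun n => ?_
  fin_cases n
  · exact atOneL2nOn_Gp_letters_0 𝔏 𝔈
  · exact atOneL2nOn_Gp_letters_1 𝔏 𝔈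
  · exact atOneL2nOn_Gp_letters_2 𝔏 𝔈
  · exact hL3
  · exact hL4
  · exact hL5

end Layer

/-! ## §2 At the record: `ops := opsYOfLetters N θ M⋆ 𝔏 𝔈` -/

section Record

open scoped Matrix.Norms.L2Operator

variable (N : ℕ) (θ : Stage3Params) (Mstar' : ℕ) (𝔏 : LettersY N θ Mstar') (𝔈 : ExpsY N θ Mstar')

/-- ★★ the (3.43) leaf of G′(1) (as typed at the record) at the record's layer of letters, every `𝔏 𝔈`.
[cite: Balaban1985BackgroundPropagators, Thm 3.1 (3.43) p.398 + Cor. 3.5 p.407; Balaban1984PropagatorsII, Prop. 2.2 (2.67) p.234 (entries 4, 5)] -/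
theorem atOneH1On_Gp_opsYOfLetters :
    AtOneH1On geo9Y (bg9Y (Matrix (Fin N) (Fin N) ℂ) (specialUnitaryUnits (Fin N))) (fun x => (opsYOfLetters N θ Mstar' 𝔏 𝔈 x).Gp)
      (fun _ lam => ¬ (lam.isRight = true)) :=
  atOneH1On_Gp_letters 𝔏 𝔈

/-- ★★ **THE KNIT BINDER `hGp` AT NODE 00's OPERATOR LAYER OF LETTERS FROM THE FIVE SECOND-ORDER LEAVES ONLY** — conclusion LITERALLY the binder `hGp`
of `Summit.…b9_main_of_up_view₁₁B10YZW_of_obligations` at `ops := opsYOfLetters N θ M⋆ 𝔏 𝔈`; hypotheses = the printed-shape (3.46) member-leaves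
`∇G′∇*`, `∇∇G′`, `G′∇*∇*` and the leaves (3.44), (3.45) for G′(1) on site arguments (G-B9-03a); (3.47), (3.46)₀,₁,₂ and (3.43) are PROVED.
[cite: Balaban1985BackgroundPropagators, Cor. 3.5 p.407 + Thm 3.1 (3.43)–(3.47) p.398; Balaban1984PropagatorsII, Prop. 2.2 (2.67), Lemma 2.1 p.234] -/
theorem hGp_opsYOfLetters_of_leaves5
    (hL3 : AtOneL2nOn geo9Y (bg9Y (Matrix (Fin N) (Fin N) ℂ) (specialUnitaryUnits (Fin N))) (fun x => (opsYOfLetters N θ Mstar' 𝔏 𝔈 x).Gp)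
      (fun _ lam => ¬ (lam.isRight = true)) 3)
    (hL4 : AtOneL2nOn geo9Y (bg9Y (Matrix (Fin N) (Fin N) ℂ) (specialUnitaryUnits (Fin N))) (fun x => (opsYOfLetters N θ Mstar' 𝔏 𝔈 x).Gp)
      (fun _ lam => ¬ (lam.isRight = true)) 4)
    (hL5 : AtOneL2nOn geo9Y (bg9Y (Matrix (Fin N) (Fin N) ℂ) (specialUnitaryUnits (Fin N))) (fun x => (opsYOfLetters N θ Mstar' 𝔏 𝔈 x).Gp)
      (fun _ lam => ¬ (lam.isRight = true)) 5)
    (hE4 : AtOneE4On geo9Y (bg9Y (Matrix (Fin N) (Fin N) ℂ) (specialUnitaryUnits (Fin N))) (fun x => (opsYOfLetters N θ Mstar' 𝔏 𝔈 x).Gp)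
      (fun _ lam => ¬ (lam.isRight = true)))
    (hH2 : AtOneH2On geo9Y (bg9Y (Matrix (Fin N) (Fin N) ℂ) (specialUnitaryUnits (Fin N))) (fun x => (opsYOfLetters N θ Mstar' 𝔏 𝔈 x).Gp)
      (fun _ lam => ¬ (lam.isRight = true))) :
    B9FromB6.ResidualGpAtOne geo9Y (bg9Y (Matrix (Fin N) (Fin N) ℂ) (specialUnitaryUnits (Fin N))) (fun x => (opsYOfLetters N θ Mstar' 𝔏 𝔈 x).Gp) :=
  residualGpAtOne_letters_of_leaves5 𝔏 𝔈 hL3 hL4 hL5 hE4 hH2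

end Record

end Literature.MathematicalPhysics.QuantumFieldTheory.Balaban1983to89.B9Ineq343GpAtLetters

end
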